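import Mathlib
import Summits.Ventures.DiscreteObjects.Mahler.Parseval4

/-!
# Smyth's theorem: the analytic core (venture `DiscreteObjects`, target L)

Cell `pub-namedobj`, seat `pub-namedobj-mahler` (gen 8). Framing: lottery ticket; floor = certified
bounds/negative ranges.

The function-theoretic heart of [McKee–Smyth, *Around the Unit Circle*, §12.2.1–12.2.3] (Smyth 1971),
abstracted from the polynomial: a pair of Schur functions `f, g` with REAL Taylor coefficients
`fₙ, gₙ`, `f₀ = g₀ = c ∈ (0,1)` (`SmythData f g c`), linked by the "nonreciprocity relations"

  `fₙ = gₙ + a·g_{n-k}·[k ≤ n] + b·c·[n = ℓ]`   (`n ≤ ℓ`, integers `a, b ≠ 0`, `1 ≤ k < ℓ`)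

(which is what `f·P* = ε P·g` and `εP = P*(1 + aX^k + bX^ℓ) + O(X^{ℓ+1})` give), must have
`c² + c³ ≤ 1`, i.e. `M = 1/c` satisfies `M³ ≥ M + 1`, i.e. `M ≥ θ₀` (`smyth_analytic`).

* `SmythData.caseA` (`ℓ < 2k`, §12.2.2, via `parseval4` and `smyth_caseA_arith`),
  `SmythData.caseB` (no `z^{2k}` term, §12.2.3, via Prop. 12.11(d) and `smyth_caseB_arith`);
* `smyth_analytic` — the case analysis `ℓ < 2k` / `ℓ > 2k` / `ℓ = 2k` with the `f ↔ g` swaps.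
-/

namespace Summit.Ventures.DiscreteObjects.Mahler

open Polynomial Metric Set Filter Topology Finset
open scoped ComplexConjugate

noncomputable section

/-! ### Smyth data -/

/-- A **Smyth pair**: Schur functions `f, g` with real Taylor coefficients and `f(0) = g(0) = c ∈ (0,1)`. -/
structure SmythData (f g : ℂ → ℂ) (c : ℝ) : Prop where
  hf : IsSchur f
  hg : IsSchur g
  freal : ∀ n, conj (jetCoeff f n) = jetCoeff f n
  greal : ∀ n, conj (jetCoeff g n) = jetCoeff g n
  f0 : jetCoeff f 0 = c
  g0 : jetCoeff g 0 = c
  cpos : 0 < c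
  clt : c < 1

namespace SmythData

variable {f g : ℂ → ℂ} {c : ℝ}

/-- The roles of `f` and `g` are symmetric. -/
theorem symm (D : SmythData f g c) : SmythData g f c :=
  ⟨D.hg, D.hf, D.greal, D.freal, D.g0, D.f0, D.cpos, D.clt⟩

/-- Real parts are the coefficients. -/
theorem re_f (D : SmythData f g c) (n : ℕ) : (((jetCoeff f n).re : ℝ) : ℂ) = jetCoeff f n :=
  Complex.conj_eq_iff_re.mp (D.freal n)

/-- `Re f₀ = c`. -/
theorem re_f0 (D : SmythData f g c) : (jetCoeff f 0).re = c := by rw [D.f0]; simp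

/-- `|fₙ| ≤ 1 - c²` for `n ≥ 1` (Prop. 12.11(b)). -/
theorem abs_re_le (D : SmythData f g c) {n : ℕ} (hn : 1 ≤ n) : |(jetCoeff f n).re| ≤ 1 - c ^ 2 := by
  have h := D.hf.norm_jetCoeff_le hn
  rw [D.f0, Complex.norm_real, Real.norm_eq_abs, abs_of_pos D.cpos] at h
  rw [← D.re_f n, Complex.norm_real, Real.norm_eq_abs] at h
  exact h

/-- Prop. 12.11(d) for `f`: bounds on `f_{2k}` in terms of `f_k` and `c`. -/
theorem two_mul_bounds (D : SmythData f g c) {k : ℕ} (hk : 1 ≤ k) :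
    (jetCoeff f (2 * k)).re ≤ 1 - c ^ 2 - (jetCoeff f k).re ^ 2 / (1 - c) ∧
      -(1 - c ^ 2) + (jetCoeff f k).re ^ 2 / (1 + c) ≤ (jetCoeff f (2 * k)).re :=
  D.hf.jetCoeff_two_mul_real_bounds hk D.f0 (D.re_f k).symm (D.re_f (2 * k)).symm
    (by rw [abs_of_pos D.cpos]; exact D.clt)

/-- **Case `ℓ > 2k` (§12.2.3).**  Relations `f_k = g_k + a c`, `f_{2k} = g_{2k} + a g_k` with an
integer `a ≠ 0` force `c² + c³ ≤ 1`. -/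
theorem caseB (D : SmythData f g c) {k : ℕ} (hk : 1 ≤ k) {a : ℤ} (ha : a ≠ 0) (hc : 3 / 4 ≤ c)
    (hrelk : (jetCoeff f k).re = (jetCoeff g k).re + a * c)
    (hrel2k : (jetCoeff f (2 * k)).re = (jetCoeff g (2 * k)).re + a * (jetCoeff g k).re) :
    c ^ 2 + c ^ 3 ≤ 1 := by
  set Fk := (jetCoeff f k).re with hFk
  set Gk := (jetCoeff g k).re with hGk
  set F2 := (jetCoeff f (2 * k)).re with hF2
  set G2 := (jetCoeff g (2 * k)).re with hG2
  have hFb := D.abs_re_le hk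
  have hGb := D.symm.abs_re_le hk
  obtain ⟨ha1, _, _⟩ := smyth_orderK hc hFb hGb ha hrelk
  obtain ⟨_, hF2lo⟩ := D.two_mul_bounds hk
  obtain ⟨hG2hi, _⟩ := D.symm.two_mul_bounds hk
  rcases ha1 with h1 | h1
  · rw [h1] at hrelk hrel2k; push_cast at hrelk hrel2k
    have hx : Fk ≤ 1 - c ^ 2 := (abs_le.mp hFb).2
    apply smyth_caseB_arith hc D.clt hx
    have e : (c - Fk) ^ 2 = Gk ^ 2 := by
      rw [show Gk = Fk - c by linarith]; ring
    rw [e]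
    linarith
  · rw [h1] at hrelk hrel2k; push_cast at hrelk hrel2k
    have hx : -Fk ≤ 1 - c ^ 2 := by have := (abs_le.mp hFb).1; linarith
    have h := smyth_caseB_arith hc D.clt hx
    apply h
    have e1 : (c - -Fk) ^ 2 = Gk ^ 2 := by
      rw [show Gk = Fk + c by linarith]; ring
    have e2 : (-Fk) ^ 2 = Fk ^ 2 := by ring
    rw [e1, e2]
    linarith

/-- Parseval inequality of §12.2.2 for `f` with `p = 1 + γ z^{ℓ-k} - z^k + β z^ℓ`. -/
theorem parsevalA_f (D : SmythData f g c) {k ℓ : ℕ} (hkl : k < ℓ) (hl : ℓ < 2 * k)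
    (β γ : ℝ) :
    c ^ 2 + ((jetCoeff f (ℓ - k)).re + γ * c) ^ 2 +
      ((jetCoeff f k).re + γ * (jetCoeff f (2 * k - ℓ)).re - c) ^ 2 +
      ((jetCoeff f ℓ).re + γ * (jetCoeff f k).re - (jetCoeff f (ℓ - k)).re + β * c) ^ 2 ≤
      2 + γ ^ 2 + β ^ 2 := by
  have hi : 0 < ℓ - k := by omega
  have hij : ℓ - k < k := by omega
  have h := parseval4 D.hf D.freal 1 γ (-1) β hi hij hkl
  rw [show k - (ℓ - k) = 2 * k - ℓ by omega, show ℓ - (ℓ - k) = k by omega, D.re_f0] at h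
  nlinarith [h]

/-- Parseval inequality of §12.2.2 for `g` with `q = -1 - γ z^{ℓ-k} - z^k + β z^ℓ`. -/
theorem parsevalA_g (D : SmythData f g c) {k ℓ : ℕ} (hkl : k < ℓ) (hl : ℓ < 2 * k)
    (β γ : ℝ) :
    c ^ 2 + ((jetCoeff g (ℓ - k)).re + γ * c) ^ 2 +
      ((jetCoeff g k).re + γ * (jetCoeff g (2 * k - ℓ)).re + c) ^ 2 +
      ((jetCoeff g ℓ).re + γ * (jetCoeff g k).re + (jetCoeff g (ℓ - k)).re - β * c) ^ 2 ≤
      2 + γ ^ 2 + β ^ 2 := by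
  have hi : 0 < ℓ - k := by omega
  have hij : ℓ - k < k := by omega
  have h := parseval4 D.hg D.greal (-1) (-γ) (-1) β hi hij hkl
  rw [show k - (ℓ - k) = 2 * k - ℓ by omega, show ℓ - (ℓ - k) = k by omega, D.symm.re_f0] at h
  nlinarith [h]

/-- **Case `ℓ < 2k` with `a = +1` (§12.2.2).** -/
theorem caseA (D : SmythData f g c) {k ℓ : ℕ} (hkl : k < ℓ) (hl : ℓ < 2 * k) {b : ℤ}
    (hb : b = 1 ∨ b = -1) (hc : 3 / 4 ≤ c) (hc2 : c / 2 ≤ 1 - c ^ 2)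
    (hy : (jetCoeff f (ℓ - k)).re = (jetCoeff g (ℓ - k)).re)
    (hw : (jetCoeff f (2 * k - ℓ)).re = (jetCoeff g (2 * k - ℓ)).re)
    (hrelk : (jetCoeff f k).re = (jetCoeff g k).re + c)
    (hrell : (jetCoeff f ℓ).re = (jetCoeff g ℓ).re + (jetCoeff g (ℓ - k)).re + b * c) :
    c ^ 2 + c ^ 3 ≤ 1 := by
  have hPf := D.parsevalA_f hkl hl
  have hPg := D.parsevalA_g hkl hl
  have hyb : |(jetCoeff f (ℓ - k)).re| ≤ 1 - c ^ 2 := D.abs_re_le (n := ℓ - k) (by omega)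
  set y := (jetCoeff f (ℓ - k)).re with hy'
  set w := (jetCoeff f (2 * k - ℓ)).re with hw'
  set Fk := (jetCoeff f k).re with hFk
  set Fl := (jetCoeff f ℓ).re with hFl
  set Gk := (jetCoeff g k).re with hGk
  set Gl := (jetCoeff g ℓ).re with hGl
  rw [← hy] at hPg hrell
  rw [← hw] at hPg
  -- the averaged inequality (12.12)
  have hcomb : ∀ β γ : ℝ, 5 * c ^ 2 / 4 + (y + γ * c) ^ 2 +
      (b * c / 2 - y / 2 + γ * c / 2 + β * c) ^ 2 ≤ 2 + γ ^ 2 + β ^ 2 := by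
    intro β γ
    have h1 := hPf β γ
    have h2 := hPg β γ
    rw [hrelk, hrell] at h1
    nlinarith [h1, h2, sq_nonneg ((Gk + c + γ * w - c) + (Gk + γ * w + c)),
      sq_nonneg ((Gl + y + b * c + γ * (Gk + c) - y + β * c) + (Gl + γ * Gk + y - β * c))]
  rcases hb with hb1 | hb1
  · subst hb1
    refine smyth_caseA_arith hc hc2 (x := -y) (by rw [abs_neg]; exact hyb) (fun β' γ' => ?_)
    have := hcomb β' (-γ')
    push_cast at this
    nlinarith [this]
  · subst hb1
    refine smyth_caseA_arith hc hc2 (x := y) hyb (fun β' γ' => ?_)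
    have := hcomb (-β') γ'
    push_cast at this
    nlinarith [this]

end SmythData

/-! ### The case analysis -/

/-- **Smyth's inequality, analytic form.**  A Smyth pair whose real coefficients satisfy the
nonreciprocity relations `fₙ = gₙ + a g_{n-k} [k ≤ n] + b c [n = ℓ]` for `n ≤ ℓ`
(`1 ≤ k < ℓ`, integers `a, b ≠ 0`) has `c² + c³ ≤ 1`. -/
theorem smyth_analytic {f g : ℂ → ℂ} {c : ℝ} (D : SmythData f g c) {k ℓ : ℕ} (hk : 1 ≤ k)
    (hkl : k < ℓ) {a b : ℤ} (ha : a ≠ 0) (hb : b ≠ 0)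
    (hrel : ∀ n, n ≤ ℓ → (jetCoeff f n).re = (jetCoeff g n).re +
      (if k ≤ n then (a : ℝ) * (jetCoeff g (n - k)).re else 0) + (if n = ℓ then (b : ℝ) * c else 0)) :
    c ^ 2 + c ^ 3 ≤ 1 := by
  by_cases hc : c < 3 / 4
  · have h0 := D.cpos
    nlinarith
  push Not at hc
  -- order `k`
  have hrelk : (jetCoeff f k).re = (jetCoeff g k).re + a * c := by
    have h := hrel k hkl.le
    rw [if_pos le_rfl, if_neg (by omega), Nat.sub_self, D.symm.re_f0] at h
    linarith
  obtain ⟨ha1, _, hc2⟩ := smyth_orderK hc (D.abs_re_le hk) (D.symm.abs_re_le hk) ha hrelk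
  -- order `ℓ`: `|b| = 1`
  have hrell : (jetCoeff f ℓ).re = (jetCoeff g ℓ).re + a * (jetCoeff g (ℓ - k)).re + b * c := by
    have h := hrel ℓ le_rfl
    rw [if_pos hkl.le, if_pos rfl] at h
    exact h
  have hb1 : b = 1 ∨ b = -1 :=
    smyth_b_bound hc ha1 (D.abs_re_le (n := ℓ) (by omega)) (D.symm.abs_re_le (n := ℓ) (by omega))
      (D.symm.abs_re_le (n := ℓ - k) (by omega)) hb hrell
  rcases Nat.lt_trichotomy ℓ (2 * k) with hlt | heq | hgt
  · -- case `ℓ < 2k`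
    have hy : (jetCoeff f (ℓ - k)).re = (jetCoeff g (ℓ - k)).re := by
      have h := hrel (ℓ - k) (by omega)
      rw [if_neg (by omega), if_neg (by omega)] at h
      linarith
    have hw : (jetCoeff f (2 * k - ℓ)).re = (jetCoeff g (2 * k - ℓ)).re := by
      have h := hrel (2 * k - ℓ) (by omega)
      rw [if_neg (by omega), if_neg (by omega)] at h
      linarith
    rcases ha1 with h1 | h1
    · subst h1
      push_cast at hrelk hrell
      exact D.caseA hkl hlt hb1 hc hc2 hy hw (by linarith) (by linarith)
    · subst h1
      push_cast at hrelk hrell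
      -- swap the roles of `f` and `g`: `a' = 1`, `b' = -b`
      have hb1' : (-b) = 1 ∨ (-b) = -1 := by omega
      refine D.symm.caseA hkl hlt hb1' hc hc2 hy.symm hw.symm (by linarith) ?_
      push_cast
      linarith
  · -- case `ℓ = 2k`: swap; `b = 1` gives case B for the swapped pair, `b = -1` is impossible
    subst heq
    rw [show 2 * k - k = k by omega] at hrell
    have haa : (a : ℝ) * a = 1 := by
      rcases ha1 with h | h <;> subst h <;> norm_num
    -- the swapped relation at order `2k`
    have hrel2 : (jetCoeff g (2 * k)).re = (jetCoeff f (2 * k)).re + ((-a : ℤ) : ℝ) * (jetCoeff f k).re +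
        (1 - b) * c := by
      push_cast
      linear_combination -hrell + (a : ℝ) * hrelk + c * haa
    have hrelk' : (jetCoeff g k).re = (jetCoeff f k).re + ((-a : ℤ) : ℝ) * c := by
      push_cast; linarith
    rcases hb1 with h1 | h1
    · subst h1
      have hrel2' : (jetCoeff g (2 * k)).re =
          (jetCoeff f (2 * k)).re + ((-a : ℤ) : ℝ) * (jetCoeff f k).re := by
        rw [hrel2]; push_cast; ring
      exact D.symm.caseB hk (a := -a) (by omega) hc hrelk' hrel2'
    · subst h1
      exfalso
      have ha1' : (-a) = 1 ∨ (-a) = -1 := by omega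
      have hrel2' : (jetCoeff g (2 * k)).re =
          (jetCoeff f (2 * k)).re + ((-a : ℤ) : ℝ) * (jetCoeff f k).re + ((2 : ℤ) : ℝ) * c := by
        rw [hrel2]; push_cast; ring
      have h2 : (2 : ℤ) = 1 ∨ (2 : ℤ) = -1 :=
        smyth_b_bound hc ha1' (D.symm.abs_re_le (n := 2 * k) (by omega))
          (D.abs_re_le (n := 2 * k) (by omega)) (D.abs_re_le (n := k) hk) (by norm_num) hrel2'
      omega
  · -- case `ℓ > 2k`
    have hrel2k : (jetCoeff f (2 * k)).re = (jetCoeff g (2 * k)).re + a * (jetCoeff g k).re := by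
      have h := hrel (2 * k) hgt.le
      rw [if_pos (by omega), if_neg (by omega), show 2 * k - k = k by omega] at h
      linarith
    exact D.caseB hk ha hc hrelk hrel2k

end

end Summit.Ventures.DiscreteObjects.Mahler
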